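import Summits.BirchSwinnertonDyer.BirchSwinnertonDyer.Theorems.ClassRecordThreeEulerHalvesAtThreeCarrierLocalE0Global
import HarnessLib

/-!
# `12` KILLS `E(L) ∕ E₀(L)_w` at an UNRAMIFIED place over an ADDITIVE prime of `E/ℚ` (Kodaira–Néron: `c_w ≤ 4` off split `I_n`)
# Cell `bsd-stepL`, seat `bsd-line-er5-p1-w5` g0 (width seat on crux 19715 `EulerHalfNotRamNoInertSetAtFive`, line `birth`);
# `--supports stmt-BirchSwinnertonDyer-19715 --as helper` (route-free; generic number field `L`, generic place)

WHY (the «modular aux-norm» road to the S1b branch's `hGZ` receptacle binder WITHOUT [GZ86 III (3.1)] = conjunct 2 of item 27981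
`EulerHalfGrossPrintFacts`): bsd-jet's transport `pointsMap_map_mem_E0Receptacle_of_forall_place` feeds `hGZ` from ONE input,
«`n' • y(m) ∈ E₀(K[m])_w` at EVERY place `w ∋ N` of `K[m]`», `n'` prime to `p`. On an S1b row (`p ≥ 5` the ONLY multiplicative
prime, every other prime of the conductor ADDITIVE) the places `w ∋ N` of the ring class field `K[m]` (`(m, N) = 1`, `K` Heegner) are
(i) over the carrier `p` — the auxiliary-norm lever (`labelE0Prime_at_carrier_of_trace_of_galTrivial_of_kills_of_auxLevel`), and
(ii) over an ADDITIVE prime `q` — THIS FILE: there the component group over the UNRAMIFIED completion `K[m]_w ∕ ℚ_q` has order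
`c_w ≤ 4` (additive reduction transports along `e = 1`, Tate's algorithm is insensitive to unramified base change; Kodaira–Néron
off split `I_n`), so `c_w ∣ 12` and `12 • P ∈ E₀(K[m])_w` for EVERY `P ∈ E(K[m])`; `5 ≤ p` gives `p ∤ 12`.

WHAT (all over the tree's theorems; `W/ℚ` globally minimal, `L` a number field, `w` a finite place of `L` UNRAMIFIED over `ℚ`
(`¬ (w ∩ ℤ)𝓞_L ≤ w²`), `W` ADDITIVE at the prime `w ∩ ℤ`):
* `localTamagawaNumber_completion_le_four_of_unramified_of_hasAdditiveReductionAt` — `c_w(W_L) ≤ 4`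
  (`hasAdditiveReductionAt_baseChange_of_ramificationIdx_eq_one` ∘ `kodairaSymbolAt_baseChange_of_ramificationIdx_eq_one_holds` ⟹ `W_L`
  additive at `w` ⟹ the minimal `W_L ⊗ L_w` is not split multiplicative ⟹ `localTamagawaNumber_le_four_of_not_hasSplitMultiplicativeReduction`);
* `localTamagawaNumber_completion_dvd_twelve_of_unramified_of_hasAdditiveReductionAt` — `c_w ∣ 12` (`0 < c_w ≤ 4`);
* `nsmul_mem_goodReductionSubgroup_of_unramified_of_localTamagawaNumber_dvd` ∕
  `twelve_nsmul_mem_goodReductionSubgroup_of_unramified_of_hasAdditiveReductionAt` — `n • Q ∈ E₀(L_w)` for every `Q ∈ E(L_w)` and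
  `c_w ∣ n`, in particular `n = 12` (`c_w = [E(L_w) : E₀(L_w)]`, `localTamagawaNumber_eq_index_goodReductionSubgroup`, `AddSubgroup.nsmul_index_mem`);
* `hasNonsingularReduction_nsmul_of_unramified_of_localTamagawaNumber_dvd` ∕
  `hasNonsingularReduction_twelve_nsmul_of_unramified_of_hasAdditiveReductionAt` — the same on `L`-points: `12 • P ∈ E₀(L)_w` for every
  `P ∈ E(L)` (tam3-p1 g18's `hasNonsingularReduction_placeIntModel_iff_mapPoint_mem`: `E₀(L)_w = E(L) ∩ E₀(L_w)`);
§3: primed twins for an ARBITRARY `DecidableEq L` on the coordinates (`Subsingleton.elim`, as in tam3-p1's `…CarrierLocalE0AtThree`).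
The ring-class-tower specialisation (`K` imaginary quadratic, `q` additive for `W` and split in `K`, `q ∤ n`, `w ∋ q` a place of
`K[n]`; unramifiedness = tam3-p1 g18's `CarrierLocalE0.not_map_le_sq_ringClassField`, p645044) is the sequel file
`ErratumRoadFiveEulerHalfModularAdditiveE0RingClass.lean` (kept apart so that this file imports only served modules).

HONEST FRAMING: THEOREMS ONLY (no definition, no named fact, no instance, no `sorry`); pure Kodaira–Néron bookkeeping over landed
tree theorems; nothing about any CM point, Selmer group or `L`-function; no stub ∕ item closes; 19715 is not closed by this; BSD is
proved for no curve (T7); no summit statement is touched.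
References (locators only): [cite: SilvermanAEC2009, Thm. VII.6.1, Prop. VII.5.4 (a)] [cite: SilvermanATAEC1994, IV Cor. 9.2 (d), Table 4.1]
[cite: Cox2013, §9.A (ring class fields unramified outside the conductor)].
presearch: «Tamagawa number additive reduction at most four unramified base change» → tree theorems only
(`localTamagawaNumber_le_four_of_not_hasSplitMultiplicativeReduction` [PastenValuationProductThm115Proofs],
`hasAdditiveReductionAt_baseChange_of_ramificationIdx_eq_one` [KodairaSymbolUnramifiedBaseChangeProofs]); corpus+galaxy not needed
(assembly of landed theorems; sources as cited there). Axioms: `propext`, `Classical.choice`, `Quot.sound`.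
-/

set_option autoImplicit false
set_option linter.dupNamespace false

noncomputable section

open scoped Classical NumberField

namespace Summit.BirchSwinnertonDyer.BirchSwinnertonDyer.Theorems.CarrierLocalE0

open WeierstrassCurve IsDedekindDomain NumberField Literature.NumberTheory.EllipticCurves
  Literature.NumberTheory.DiophantineGeometry Literature.NumberTheory.Automorphic IsLocalRing
  Literature.NumberTheory.GaloisRepresentations Summit.BirchSwinnertonDyer.Rank1Residual.X11b.Three

variable (W : WeierstrassCurve ℚ) [W.IsElliptic] [W.IsGloballyMinimal]
  {L : Type} [Field L] [NumberField L] (w : HeightOneSpectrum (𝓞 L))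

/-! ### §1 Over the completion `L_w` of an unramified place over an additive prime -/

omit [W.IsGloballyMinimal] in
/-- **`c_w(W_L) ≤ 4` at an UNRAMIFIED place over an ADDITIVE prime.** `W/ℚ` globally minimal, `w` unramified over `ℚ`, `W` additive
at `w ∩ ℤ`: additive reduction transports along `e(w | w ∩ ℤ) = 1` (Tate's algorithm is insensitive to unramified base change), so the
minimal `W_L ⊗ L_w` is not split multiplicative and Kodaira–Néron gives `c_w ≤ 4`. [cite: SilvermanAEC2009, Thm. VII.6.1]
[cite: SilvermanATAEC1994, IV Cor. 9.2 (d), Table 4.1] -/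
theorem localTamagawaNumber_completion_le_four_of_unramified_of_hasAdditiveReductionAt
    (he : ¬ (w.under (𝓞 ℚ)).asIdeal.map (algebraMap (𝓞 ℚ) (𝓞 L)) ≤ w.asIdeal ^ 2)
    (hadd : W.HasAdditiveReductionAt (w.under (𝓞 ℚ))) :
    ((W.baseChange L).baseChange (w.adicCompletion L)).localTamagawaNumber (w.adicCompletionIntegers L) ≤ 4 := by
  classical
  haveI : Finite (ResidueField (w.adicCompletionIntegers L)) :=
    HeightOneSpectrum.finite_residueField_adicCompletionIntegers L w
  haveI : PerfectField (ResidueField (w.adicCompletionIntegers L)) := PerfectField.ofFinite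
  haveI : ((W.baseChange L).baseChange (w.adicCompletion L)).IsElliptic := by
    unfold WeierstrassCurve.baseChange; infer_instance
  haveI hWL : (W.baseChange L).IsElliptic := by unfold WeierstrassCurve.baseChange; infer_instance
  have haddw : (W.baseChange L).HasAdditiveReductionAt w :=
    hasAdditiveReductionAt_baseChange_of_ramificationIdx_eq_one
      (kodairaSymbolAt_baseChange_of_ramificationIdx_eq_one_holds L (w.under (𝓞 ℚ)) w W)
      (algebraMap_comp_eq (L := L)) rfl he hadd
  have hns : ¬ (((W.baseChange L).baseChange (w.adicCompletion L)).minimal (w.adicCompletionIntegers L)).HasSplitMultiplicativeReduction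
      (w.adicCompletionIntegers L) := fun hsp ↦
    WeierstrassCurve.HasMultiplicativeReductionAt.not_hasAdditiveReductionAt (W := W.baseChange L) (v := w)
      hsp.toHasMultiplicativeReduction haddw
  exact localTamagawaNumber_le_four_of_not_hasSplitMultiplicativeReduction (w.adicCompletionIntegers L) _ hns

omit [W.IsGloballyMinimal] in
/-- **`c_w(W_L) ∣ 12`** at an unramified place over an additive prime (`0 < c_w ≤ 4`). [cite: SilvermanATAEC1994, IV Cor. 9.2 (d), Table 4.1] -/
theorem localTamagawaNumber_completion_dvd_twelve_of_unramified_of_hasAdditiveReductionAt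
    (he : ¬ (w.under (𝓞 ℚ)).asIdeal.map (algebraMap (𝓞 ℚ) (𝓞 L)) ≤ w.asIdeal ^ 2)
    (hadd : W.HasAdditiveReductionAt (w.under (𝓞 ℚ))) :
    ((W.baseChange L).baseChange (w.adicCompletion L)).localTamagawaNumber (w.adicCompletionIntegers L) ∣ 12 := by
  classical
  haveI : ((W.baseChange L).baseChange (w.adicCompletion L)).IsElliptic := by
    unfold WeierstrassCurve.baseChange; infer_instance
  have hle := localTamagawaNumber_completion_le_four_of_unramified_of_hasAdditiveReductionAt W w he hadd
  have hne : ((W.baseChange L).baseChange (w.adicCompletion L)).localTamagawaNumber (w.adicCompletionIntegers L) ≠ 0 :=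
    WeierstrassCurve.localTamagawaNumber_ne_zero_holds (w.adicCompletionIntegers L) _
  set c := ((W.baseChange L).baseChange (w.adicCompletion L)).localTamagawaNumber (w.adicCompletionIntegers L) with hc
  interval_cases c
  · exact (hne rfl).elim
  all_goals norm_num

/-- **`n • Q ∈ E₀(L_w)` for every `Q ∈ E(L_w)` and every multiple `n` of `c_w`** (`w` unramified over `ℚ`, so `W_L ⊗ L_w` is minimal and
`c_w = [E(L_w) : E₀(L_w)]`). [cite: SilvermanAEC2009, Thm. VII.6.1] -/
theorem nsmul_mem_goodReductionSubgroup_of_unramified_of_localTamagawaNumber_dvd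
    (he : ¬ (w.under (𝓞 ℚ)).asIdeal.map (algebraMap (𝓞 ℚ) (𝓞 L)) ≤ w.asIdeal ^ 2) (n : ℕ)
    (hn : ((W.baseChange L).baseChange (w.adicCompletion L)).localTamagawaNumber (w.adicCompletionIntegers L) ∣ n)
    (Q : ((W.baseChange L).baseChange (w.adicCompletion L)).toAffine.Point) :
    haveI := isMinimal_baseChange_adicCompletion_of_unramified W w he
    n • Q ∈ ((W.baseChange L).baseChange (w.adicCompletion L)).goodReductionSubgroup (w.adicCompletionIntegers L) := by
  haveI := isMinimal_baseChange_adicCompletion_of_unramified W w he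
  haveI : ((W.baseChange L).baseChange (w.adicCompletion L)).IsElliptic := by
    unfold WeierstrassCurve.baseChange; infer_instance
  obtain ⟨k, hk⟩ := hn
  have hmem : ((W.baseChange L).baseChange (w.adicCompletion L)).localTamagawaNumber (w.adicCompletionIntegers L) • Q ∈
      ((W.baseChange L).baseChange (w.adicCompletion L)).goodReductionSubgroup (w.adicCompletionIntegers L) := by
    rw [WeierstrassCurve.localTamagawaNumber_eq_index_goodReductionSubgroup]
    exact AddSubgroup.nsmul_index_mem _ Q
  rw [hk, mul_nsmul]
  exact AddSubgroup.nsmul_mem _ hmem k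

/-- **`12 • Q ∈ E₀(L_w)` for every `Q ∈ E(L_w)`** at an unramified place over an additive prime: `c_w = [E(L_w) : E₀(L_w)]` kills the
quotient and divides `12`. [cite: SilvermanAEC2009, Thm. VII.6.1] [cite: SilvermanATAEC1994, IV Cor. 9.2 (d)] -/
theorem twelve_nsmul_mem_goodReductionSubgroup_of_unramified_of_hasAdditiveReductionAt
    (he : ¬ (w.under (𝓞 ℚ)).asIdeal.map (algebraMap (𝓞 ℚ) (𝓞 L)) ≤ w.asIdeal ^ 2)
    (hadd : W.HasAdditiveReductionAt (w.under (𝓞 ℚ)))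
    (Q : ((W.baseChange L).baseChange (w.adicCompletion L)).toAffine.Point) :
    haveI := isMinimal_baseChange_adicCompletion_of_unramified W w he
    (12 : ℕ) • Q ∈ ((W.baseChange L).baseChange (w.adicCompletion L)).goodReductionSubgroup (w.adicCompletionIntegers L) :=
  nsmul_mem_goodReductionSubgroup_of_unramified_of_localTamagawaNumber_dvd W w he 12
    (localTamagawaNumber_completion_dvd_twelve_of_unramified_of_hasAdditiveReductionAt W w he hadd) Q

/-! ### §2 On `L`-points for the model `W` at `w` -/

/-- **`n • P ∈ E₀(L)_w` for every `P ∈ E(L)` and every multiple `n` of `c_w`** at an unramified place `w` of `L`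
(`E₀(L)_w = E(L) ∩ E₀(L_w)`, tam3-p1 g18's `hasNonsingularReduction_placeIntModel_iff_mapPoint_mem`). [cite: SilvermanAEC2009, Thm. VII.6.1, VII §2 Prop. 2.1] -/
theorem hasNonsingularReduction_nsmul_of_unramified_of_localTamagawaNumber_dvd
    (he : ¬ (w.under (𝓞 ℚ)).asIdeal.map (algebraMap (𝓞 ℚ) (𝓞 L)) ≤ w.asIdeal ^ 2) (n : ℕ)
    (hn : ((W.baseChange L).baseChange (w.adicCompletion L)).localTamagawaNumber (w.adicCompletionIntegers L) ∣ n)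
    (P : (W.baseChange L).toAffine.Point) :
    (placeIntModel W L w).HasNonsingularReduction (K := L) (n • P) := by
  rw [hasNonsingularReduction_placeIntModel_iff_mapPoint_mem W w he, map_nsmul]
  exact nsmul_mem_goodReductionSubgroup_of_unramified_of_localTamagawaNumber_dvd W w he n hn _

/-- **`12 • P ∈ E₀(L)_w` for every `P ∈ E(L)`** at an unramified place `w` of `L` over an ADDITIVE prime of the globally minimal `W/ℚ`.
[cite: SilvermanAEC2009, Thm. VII.6.1, VII §2 Prop. 2.1] [cite: SilvermanATAEC1994, IV Cor. 9.2 (d), Table 4.1] -/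
theorem hasNonsingularReduction_twelve_nsmul_of_unramified_of_hasAdditiveReductionAt
    (he : ¬ (w.under (𝓞 ℚ)).asIdeal.map (algebraMap (𝓞 ℚ) (𝓞 L)) ≤ w.asIdeal ^ 2)
    (hadd : W.HasAdditiveReductionAt (w.under (𝓞 ℚ))) (P : (W.baseChange L).toAffine.Point) :
    (placeIntModel W L w).HasNonsingularReduction (K := L) (12 • P) :=
  hasNonsingularReduction_nsmul_of_unramified_of_localTamagawaNumber_dvd W w he 12
    (localTamagawaNumber_completion_dvd_twelve_of_unramified_of_hasAdditiveReductionAt W w he hadd) P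

/-! ### §3 The same for an ARBITRARY `DecidableEq L` on the coordinates (the ring class fields `K[n] ⊂ ℂ` carry their own) -/

/-- `n • P ∈ E₀(L)_w` for `c_w ∣ n`, for an ARBITRARY `DecidableEq L` instance on the coordinates (the statement above carries the
classical one; `DecidableEq L` is a subsingleton — tam3-p1 g18's device of `…CarrierLocalE0AtThree`). [cite: SilvermanAEC2009, Thm. VII.6.1] -/
theorem hasNonsingularReduction_nsmul_of_unramified_of_localTamagawaNumber_dvd' (W : WeierstrassCurve ℚ) [W.IsElliptic]
    [W.IsGloballyMinimal] {L : Type} [Field L] [NumberField L] [DecidableEq L] (w : HeightOneSpectrum (𝓞 L))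
    (he : ¬ (w.under (𝓞 ℚ)).asIdeal.map (algebraMap (𝓞 ℚ) (𝓞 L)) ≤ w.asIdeal ^ 2) (n : ℕ)
    (hn : ((W.baseChange L).baseChange (w.adicCompletion L)).localTamagawaNumber (w.adicCompletionIntegers L) ∣ n)
    (P : (W.baseChange L).toAffine.Point) :
    (placeIntModel W L w).HasNonsingularReduction (K := L) (n • P) := by
  obtain rfl : ‹DecidableEq L› = fun a b ↦ Classical.propDecidable (a = b) := Subsingleton.elim _ _
  exact hasNonsingularReduction_nsmul_of_unramified_of_localTamagawaNumber_dvd W w he n hn P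

/-- `12 • P ∈ E₀(L)_w` at an unramified place over an additive prime, for an ARBITRARY `DecidableEq L` instance on the coordinates.
[cite: SilvermanAEC2009, Thm. VII.6.1] [cite: SilvermanATAEC1994, IV Cor. 9.2 (d), Table 4.1] -/
theorem hasNonsingularReduction_twelve_nsmul_of_unramified_of_hasAdditiveReductionAt' (W : WeierstrassCurve ℚ) [W.IsElliptic]
    [W.IsGloballyMinimal] {L : Type} [Field L] [NumberField L] [DecidableEq L] (w : HeightOneSpectrum (𝓞 L))
    (he : ¬ (w.under (𝓞 ℚ)).asIdeal.map (algebraMap (𝓞 ℚ) (𝓞 L)) ≤ w.asIdeal ^ 2)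
    (hadd : W.HasAdditiveReductionAt (w.under (𝓞 ℚ))) (P : (W.baseChange L).toAffine.Point) :
    (placeIntModel W L w).HasNonsingularReduction (K := L) (12 • P) := by
  obtain rfl : ‹DecidableEq L› = fun a b ↦ Classical.propDecidable (a = b) := Subsingleton.elim _ _
  exact hasNonsingularReduction_twelve_nsmul_of_unramified_of_hasAdditiveReductionAt W w he hadd P

end Summit.BirchSwinnertonDyer.BirchSwinnertonDyer.Theorems.CarrierLocalE0

end
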